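import Mathlib
import Summits.Ventures.HodgeRepro2.Tier7.Target
import Summits.Ventures.HodgeRepro2.Tier7.Common.Datum
import Summits.Ventures.HodgeRepro2.Tier7.Line1.Defs
import Summits.Ventures.HodgeRepro2.Tier7.Line1.WedgeNonzero

/-!
# Tier7/Line1/WedgePencil — the pencil reading of L1.1 / L1.1′: Castelnuovo–de Franchis over the shadow (t7-L1-p4)

Cell pub-hodge-repro2, Tier 7 (README §11–§12), LINE L1, prover t7-L1-p4 — the «sharper displayed form» of the
assignment (plan-1 LEMMAS.md §3 p4; plan-1 l. 14688). Sorry-free; imports: Mathlib, `Tier7.Target`,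
`Tier7.Common.Datum` (typer: `thetaBase`, `heckeSpan_thetaBase`, `actLinear`, `act_ne_zero_iff`), `Tier7.Line1.Defs`,
`Tier7.Line1.WedgeNonzero` (the input `WedgeNonzero` / `WedgeNonzeroBar`).

What a zero wedge means on a surface is Castelnuovo–de Franchis: two independent holomorphic 1-forms with
`ω₁ ∧ ω₂ = 0` are pulled back from an irrational pencil `X → B`, `g(B) ≥ 2` (Beauville 1996 Prop. X.9 — displayed by
t7-lit-3 as `Hyp.Beauville1996_X_9`; Catanese, LNM 1938 (2008) Thm 4.1 — route/SOURCES.md §S16: an isotropic subspace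
of dimension ≥ 2 lies in `f^*H⁰(B, Ω¹_B)`). The shadow carries no curves, so the pencil is typed by its ONLY trace in
the cohomology ring: the subspace `f^*H⁰(B, Ω¹_B) ⊂ H^{1,0}`, on which the cup product vanishes identically
(`WedgeIsotropic`). `PencilShadow S` displays, for every 1-form `a`, THE maximal isotropic subspace `pencil a ∋ a`
(= `f_a^*H⁰(B_a, Ω¹_{B_a})` for the unique pencil `f_a` through `a`, or the line `ℂ a` if there is none; on the tower
the union over the levels), together with graded commutativity of 1-forms. Its fields and their print status are in
the structure's docstring; `pencil_max` is the one field that is NOT a printed sentence as typed (uniqueness of the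
pencil through a non-zero 1-form — the tangent argument, paper proof proofs/t7/L1/L1.1-p4.md §2).

THEOREM (kernel): if EVERY Hecke translate of the wedge vanishes, then `omega 0 ⊔ omega 1` — both theta-lift summands —
lie in ONE Hecke-STABLE isotropic subspace of `H^{1,0}` (`exists_stable_isotropic_of_forall_wedge_eq_zero`): a
`G`-equivariant irrational pencil on the tower swallowing both summands. Hence (`wedgeNonzero_iff_no_stable_isotropic`)
under `PencilShadow`:
`WedgeNonzero D ↔ no Hecke-stable isotropic subspace of H^{1,0} contains both omega 0 and omega 1`.
HONEST STATUS: the right-hand side is the geometric NAME of L1.1, not a printed input — it is equivalent to L1.1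
(both directions proved here), implied by (P), and it FAILS in the square-zero datum (there `H10` itself is stable and
isotropic). `PencilShadow` alone does NOT give it: `pencilShadow_of_mul_eq_bot` builds a `PencilShadow` on every
square-zero datum, where `WedgeNonzero` is false. So no printed input short of (P) closes L1.1 (plan-1 l. 14674, agreed);
what this module adds is the exact shape of the obstruction — a `G`-stable pencil carrying both theta summands — which
is what a disproof of L1.1 would have to exhibit, and what the Hecke density `heckeSpan_thetaBase` turns a single
zero wedge into.

§8(d): uses an L-value-free non-vanishing device: NO (no non-vanishing is claimed here; the geometric meaning of an
input is proved).
-/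

namespace Summit.Ventures.HodgeRepro2.Tier7.Line1

open Summit.Ventures.HodgeRepro2.Tier7

noncomputable section

variable {K : Type} [Field K] [NumberField K] {E' : Type} [Field E'] [NumberField E']
  {V : Type} [AddCommGroup V] [Module E' V] {HX : Type} [Ring HX] [Algebra ℂ HX]
  {G : Type} [Group G] [MulAction G HX]

/-! ## 2. The pencil reading: isotropic subspaces of `H^{1,0}` and the Castelnuovo–de Franchis shadow -/

/-- A subspace of the cohomology ring on which the cup product vanishes identically — the trace in `H^*(X, ℂ)` of
an irrational pencil: `f^*H⁰(B, Ω¹_B)` is isotropic because `Ω²_B = 0` on a curve. -/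
def WedgeIsotropic (P : Submodule ℂ HX) : Prop := ∀ a ∈ P, ∀ b ∈ P, a * b = 0

/-- The span of a set whose pairwise products vanish is isotropic (bilinearity of the product). -/
theorem wedgeIsotropic_span {s : Set HX} (h : ∀ x ∈ s, ∀ y ∈ s, x * y = 0) :
    WedgeIsotropic (Submodule.span ℂ s) := by
  intro a ha b hb
  induction ha using Submodule.span_induction with
  | mem x hx =>
    induction hb using Submodule.span_induction with
    | mem y hy => exact h x hx y hy
    | zero => exact mul_zero x
    | add y z _ _ hy hz => rw [mul_add, hy, hz, add_zero]
    | smul c y _ hy => rw [Algebra.mul_smul_comm, hy, smul_zero]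
  | zero => exact zero_mul b
  | add x y _ _ hx hy => rw [add_mul, hx, hy, add_zero]
  | smul c x _ hx => rw [Algebra.smul_mul_assoc, hx, smul_zero]

/-- A Hecke translate of an isotropic subspace is isotropic (`act_mul`, `act_zero`). -/
theorem wedgeIsotropic_map (S : SurfaceShadow HX G) {P : Submodule ℂ HX} (hP : WedgeIsotropic P) (g : G) :
    WedgeIsotropic (P.map (S.actLinear g)) := by
  intro a ha b hb
  obtain ⟨a', ha', rfl⟩ := Submodule.mem_map.mp ha
  obtain ⟨b', hb', rfl⟩ := Submodule.mem_map.mp hb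
  simp only [SurfaceShadow.actLinear_apply]
  rw [← S.act_mul, hP a' ha' b' hb', S.act_zero]

/-- THE CASTELNUOVO–DE FRANCHIS SHADOW of the surface `X` (its tower): what the cohomology ring sees of the
irrational pencils of `X`. Fields and print status:
* `anticomm`: graded commutativity of the cup product for classes of degree 1, `α ∪ β = −β ∪ α` (Hodge theory /
  de Rham: the wedge of 1-forms anticommutes; the same source as the datum's `comm_H20`). PRINTED (folklore).
* `pencil a`: for a holomorphic 1-form `a`, the subspace `f_a^*H⁰(B_a, Ω¹_{B_a}) ⊂ H^{1,0}` of the irrational pencil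
  `f_a : X → B_a` through `a` (union over the levels of the tower), or the line `ℂ a` if `a` is pulled back from no
  pencil; `pencil_le`, `mem_pencil`: it is a subspace of `H^{1,0}` containing `a`. DEFINITION.
* `pencil_isotropic`: 2-forms pulled back from a curve vanish (`Ω²_B = 0`, `dim B = 1`). PRINTED (folklore).
* `pencil_max`: every isotropic subspace `Q ∋ a` lies in `pencil a` — Castelnuovo–de Franchis (Beauville 1996 Prop. X.9,
  displayed as `Hyp.Beauville1996_X_9` by t7-lit-3; Catanese, LNM 1938 (2008) Thm 4.1, route/SOURCES.md §S16: an
  isotropic subspace of dimension ≥ 2 lies in `f^*H⁰(B, Ω¹_B)` for some pencil `f`) PLUS the uniqueness of the pencil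
  through a non-zero 1-form (`f^*α = f'^*α' ≠ 0 ⇒ f = f'`: both fibrations are tangent to `ker a` at a general point
  of the surface, so their fibres coincide — the tangent argument; paper proof proofs/t7/L1/L1.1-p4.md §2). NOT a
  printed sentence as typed: the first half is printed (locators above), the uniqueness half is a paper lemma of
  this seat, so a consumer of `PencilShadow` consumes that lemma.
NON-VACUITY: `pencilShadow_of_mul_eq_bot` exhibits a `PencilShadow` on every square-zero datum. -/
structure PencilShadow (S : SurfaceShadow HX G) where
  /-- graded commutativity of 1-forms: `a ∧ b = −(b ∧ a)` -/
  anticomm : ∀ a ∈ S.H10, ∀ b ∈ S.H10, a * b = -(b * a)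
  /-- the pencil subspace through a 1-form (`f_a^*H⁰(B_a, Ω¹_{B_a})`, or `ℂ a`) -/
  pencil : HX → Submodule ℂ HX
  /-- it consists of holomorphic 1-forms -/
  pencil_le : ∀ a ∈ S.H10, pencil a ≤ S.H10
  /-- it is isotropic (for `a ≠ 0`): `Ω²_B = 0` on a curve -/
  pencil_isotropic : ∀ a ∈ S.H10, a ≠ 0 → WedgeIsotropic (pencil a)
  /-- it contains `a` -/
  mem_pencil : ∀ a ∈ S.H10, a ∈ pencil a
  /-- Castelnuovo–de Franchis + uniqueness of the pencil through `a ≠ 0`: every isotropic subspace of `H^{1,0}`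
  containing `a` lies in `pencil a` -/
  pencil_max : ∀ a ∈ S.H10, a ≠ 0 → ∀ Q : Submodule ℂ HX, Q ≤ S.H10 → WedgeIsotropic Q → a ∈ Q → Q ≤ pencil a

namespace PencilShadow

variable {S : SurfaceShadow HX G}

/-- a holomorphic 1-form squares to zero (`a ∧ a = −a ∧ a`, characteristic 0) -/
theorem mul_self_eq_zero (hP : PencilShadow S) {a : HX} (ha : a ∈ S.H10) : a * a = 0 := by
  have h := hP.anticomm a ha a ha
  have h2 : (2 : ℂ) • (a * a) = 0 := by
    rw [two_smul]
    nth_rewrite 1 [h]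
    exact neg_add_cancel _
  exact (smul_eq_zero.mp h2).resolve_left two_ne_zero

/-- the pencil through a translate contains the translate of the pencil, and vice versa: for `a ≠ 0` in `H^{1,0}`
and a Hecke translate `g`, `g • pencil a ≤ pencil (g • a)` -/
theorem map_pencil_le (hP : PencilShadow S) {a : HX} (ha : a ∈ S.H10) (h0 : a ≠ 0) (g : G) :
    (hP.pencil a).map (S.actLinear g) ≤ hP.pencil (g • a) := by
  apply hP.pencil_max (g • a) (S.act_H10 g a ha) ((S.act_ne_zero_iff g a).mpr h0)
  · rintro _ ⟨b, hb, rfl⟩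
    exact S.act_H10 g b (hP.pencil_le a ha hb)
  · exact wedgeIsotropic_map S (hP.pencil_isotropic a ha h0) g
  · exact Submodule.mem_map_of_mem (hP.mem_pencil a ha)

/-- two non-zero 1-forms lying in each other's pencils have the same pencil -/
theorem pencil_eq_of_mem (hP : PencilShadow S) {a b : HX} (ha : a ∈ S.H10) (h0 : a ≠ 0) (hb : b ∈ S.H10)
    (hb0 : b ≠ 0)
    (hab : a ∈ hP.pencil b) (hba : b ∈ hP.pencil a) : hP.pencil a = hP.pencil b :=
  le_antisymm (hP.pencil_max b hb hb0 _ (hP.pencil_le a ha) (hP.pencil_isotropic a ha h0) hba)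
    (hP.pencil_max a ha h0 _ (hP.pencil_le b hb) (hP.pencil_isotropic b hb hb0) hab)

end PencilShadow

/-- In every square-zero datum (`H10 * H10 = ⊥`, the datum of record) there is a `PencilShadow`: everything is
isotropic and `pencil a := H10`. So `PencilShadow` alone never gives `WedgeNonzero` (two-sided record). -/
def pencilShadow_of_mul_eq_bot (S : SurfaceShadow HX G) (hbot : S.H10 * S.H10 = ⊥) : PencilShadow S where
  anticomm := by
    intro a ha b hb
    have h1 : a * b = 0 := by
      have := Submodule.mul_mem_mul ha hb
      rwa [hbot, Submodule.mem_bot] at this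
    have h2 : b * a = 0 := by
      have := Submodule.mul_mem_mul hb ha
      rwa [hbot, Submodule.mem_bot] at this
    rw [h1, h2, neg_zero]
  pencil := fun _ => S.H10
  pencil_le := fun _ _ => le_rfl
  pencil_isotropic := by
    intro _ _ _ a ha b hb
    have := Submodule.mul_mem_mul ha hb
    rwa [hbot, Submodule.mem_bot] at this
  mem_pencil := fun _ ha => ha
  pencil_max := fun _ _ _ _ hQ _ _ => hQ

/-! ## 3. A zero wedge on the whole Hecke orbit is a Hecke-stable pencil through both theta summands -/

section Pencil

variable (D : PeriodDatum K E' V HX G)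

/-- THE PENCIL THEOREM (kernel). If every Hecke translate of `θ(μ_i)` wedges to zero with `θ(μ_j)` and `θ(μ_i)`
wedges to zero with every Hecke translate of `θ(μ_j)`, then `omega i ⊔ omega j` lies in ONE Hecke-stable isotropic
subspace of `H^{1,0}`: under `PencilShadow`, the pencil `P := pencil θ(μ_j)`. Proof: (1) for every `h`, `{h • θ_i, θ_j}`
spans an isotropic subspace (graded commutativity + the hypotheses), so `h • θ_i ∈ P` (`pencil_max`), hence
`omega i = span {h • θ_i} ≤ P` (Hecke density, `heckeSpan_thetaBase`); (2) symmetrically `omega j ≤ pencil θ_i`, and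
`pencil θ_i = P` since each contains the other's base point (`pencil_eq_of_mem`); (3) `P` is Hecke-stable:
`g • P ≤ pencil (g • θ_j)` (`map_pencil_le`) `= P`, because `g • θ_j ∈ omega j ≤ P` and `θ_j ∈ P ≤ pencil (g • θ_j)`. -/
theorem exists_stable_isotropic_of_forall_mul_eq_zero (hP : PencilShadow D.S) (i j : Fin 4)
    (hij : ∀ h : G, (h • D.thetaBase i) * D.thetaBase j = 0)
    (hji : ∀ h : G, D.thetaBase i * (h • D.thetaBase j) = 0) :
    ∃ P : Submodule ℂ HX, P ≤ D.S.H10 ∧ HeckeStable G P ∧ WedgeIsotropic P ∧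
      D.omega i ≤ P ∧ D.omega j ≤ P := by
  have hi_H : D.thetaBase i ∈ D.S.H10 := D.thetaBase_mem_H10 i
  have hj_H : D.thetaBase j ∈ D.S.H10 := D.thetaBase_mem_H10 j
  have hi_ne : D.thetaBase i ≠ 0 := D.thetaBase_ne_zero i
  have hj_ne : D.thetaBase j ≠ 0 := D.thetaBase_ne_zero j
  -- (1) every translate of `θ_i` lies in `pencil θ_j`
  have h1 : ∀ h : G, h • D.thetaBase i ∈ hP.pencil (D.thetaBase j) := by
    intro h
    have hh : h • D.thetaBase i ∈ D.S.H10 := D.S.act_H10 h _ hi_H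
    have hQ : WedgeIsotropic (Submodule.span ℂ {h • D.thetaBase i, D.thetaBase j}) := by
      apply wedgeIsotropic_span
      intro x hx y hy
      simp only [Set.mem_insert_iff, Set.mem_singleton_iff] at hx hy
      rcases hx with rfl | rfl <;> rcases hy with rfl | rfl
      · exact hP.mul_self_eq_zero hh
      · exact hij h
      · rw [hP.anticomm _ hj_H _ hh, hij h, neg_zero]
      · exact hP.mul_self_eq_zero hj_H
    have hQle : Submodule.span ℂ {h • D.thetaBase i, D.thetaBase j} ≤ D.S.H10 := by
      rw [Submodule.span_le]
      intro x hx
      simp only [Set.mem_insert_iff, Set.mem_singleton_iff] at hx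
      rcases hx with rfl | rfl
      · exact hh
      · exact hj_H
    exact hP.pencil_max _ hj_H hj_ne _ hQle hQ (Submodule.subset_span (by simp))
      (Submodule.subset_span (by simp))
  have hωi : D.omega i ≤ hP.pencil (D.thetaBase j) := by
    rw [← D.heckeSpan_thetaBase i]
    apply Submodule.span_le.mpr
    rintro _ ⟨h, rfl⟩
    exact h1 h
  -- (2) every translate of `θ_j` lies in `pencil θ_i`
  have h2 : ∀ h : G, h • D.thetaBase j ∈ hP.pencil (D.thetaBase i) := by
    intro h
    have hh : h • D.thetaBase j ∈ D.S.H10 := D.S.act_H10 h _ hj_H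
    have hQ : WedgeIsotropic (Submodule.span ℂ {D.thetaBase i, h • D.thetaBase j}) := by
      apply wedgeIsotropic_span
      intro x hx y hy
      simp only [Set.mem_insert_iff, Set.mem_singleton_iff] at hx hy
      rcases hx with rfl | rfl <;> rcases hy with rfl | rfl
      · exact hP.mul_self_eq_zero hi_H
      · exact hji h
      · rw [hP.anticomm _ hh _ hi_H, hji h, neg_zero]
      · exact hP.mul_self_eq_zero hh
    have hQle : Submodule.span ℂ {D.thetaBase i, h • D.thetaBase j} ≤ D.S.H10 := by
      rw [Submodule.span_le]
      intro x hx
      simp only [Set.mem_insert_iff, Set.mem_singleton_iff] at hx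
      rcases hx with rfl | rfl
      · exact hi_H
      · exact hh
    exact hP.pencil_max _ hi_H hi_ne _ hQle hQ (Submodule.subset_span (by simp))
      (Submodule.subset_span (by simp))
  have hωj : D.omega j ≤ hP.pencil (D.thetaBase i) := by
    rw [← D.heckeSpan_thetaBase j]
    apply Submodule.span_le.mpr
    rintro _ ⟨h, rfl⟩
    exact h2 h
  -- the two pencils coincide
  have hij_mem : D.thetaBase i ∈ hP.pencil (D.thetaBase j) := hωi (D.thetaBase_mem_omega i)
  have hji_mem : D.thetaBase j ∈ hP.pencil (D.thetaBase i) := hωj (D.thetaBase_mem_omega j)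
  have hEq : hP.pencil (D.thetaBase i) = hP.pencil (D.thetaBase j) :=
    hP.pencil_eq_of_mem hi_H hi_ne hj_H hj_ne hij_mem hji_mem
  refine ⟨hP.pencil (D.thetaBase j), hP.pencil_le _ hj_H, ?_, hP.pencil_isotropic _ hj_H hj_ne, hωi, hEq ▸ hωj⟩
  -- (3) Hecke stability
  intro g a ha
  have hgj_H : g • D.thetaBase j ∈ D.S.H10 := D.S.act_H10 g _ hj_H
  have hgj_ne : g • D.thetaBase j ≠ 0 := (D.S.act_ne_zero_iff g _).mpr hj_ne
  -- `g • θ_j ∈ omega j ≤ P`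
  have hgj_mem : g • D.thetaBase j ∈ hP.pencil (D.thetaBase j) :=
    (hEq ▸ hωj) ((D.omega_irred j).2.1 g _ (D.thetaBase_mem_omega j))
  -- `P ≤ pencil (g • θ_j)` and `θ_j ∈ pencil (g • θ_j)`, so `pencil (g • θ_j) = P`
  have hPle : hP.pencil (D.thetaBase j) ≤ hP.pencil (g • D.thetaBase j) :=
    hP.pencil_max _ hgj_H hgj_ne _ (hP.pencil_le _ hj_H) (hP.pencil_isotropic _ hj_H hj_ne) hgj_mem
  have hEq' : hP.pencil (g • D.thetaBase j) = hP.pencil (D.thetaBase j) :=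
    hP.pencil_eq_of_mem hgj_H hgj_ne hj_H hj_ne hgj_mem (hPle (hP.mem_pencil _ hj_H))
  have hmap := hP.map_pencil_le hj_H hj_ne g (Submodule.mem_map_of_mem (f := D.S.actLinear g) ha)
  rw [hEq'] at hmap
  simpa using hmap

/-- (corners `0, 1`) if EVERY Hecke translate of the wedge `f^*Ω_s = θ(μ_0) ∧ θ(μ_1)` vanishes, both theta summands
`omega 0`, `omega 1` lie in one Hecke-stable isotropic subspace of `H^{1,0}`: a `G`-equivariant irrational pencil on
the tower. -/
theorem exists_stable_isotropic_of_forall_wedge_eq_zero (hP : PencilShadow D.S)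
    (h0 : ∀ g : Fin 4 → G, D.fOmegaS g = 0) :
    ∃ P : Submodule ℂ HX, P ≤ D.S.H10 ∧ HeckeStable G P ∧ WedgeIsotropic P ∧
      D.omega 0 ≤ P ∧ D.omega 1 ≤ P := by
  apply exists_stable_isotropic_of_forall_mul_eq_zero D hP 0 1
  · intro h
    have := h0 ![h, 1, 1, 1]
    simpa [PeriodDatum.fOmegaS, PeriodDatum.theta, PeriodDatum.thetaBase] using this
  · intro h
    have := h0 ![1, h, 1, 1]
    simpa [PeriodDatum.fOmegaS, PeriodDatum.theta, PeriodDatum.thetaBase] using this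

/-- (corners `2, 3`) the same for `f^*Ω_{s̄} = θ(μ_2) ∧ θ(μ_3)`. -/
theorem exists_stable_isotropic_of_forall_wedgeBar_eq_zero (hP : PencilShadow D.S)
    (h0 : ∀ g : Fin 4 → G, D.fOmegaSbar g = 0) :
    ∃ P : Submodule ℂ HX, P ≤ D.S.H10 ∧ HeckeStable G P ∧ WedgeIsotropic P ∧
      D.omega 2 ≤ P ∧ D.omega 3 ≤ P := by
  apply exists_stable_isotropic_of_forall_mul_eq_zero D hP 2 3
  · intro h
    have := h0 ![1, 1, h, 1]
    simpa [PeriodDatum.fOmegaSbar, PeriodDatum.theta, PeriodDatum.thetaBase] using this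
  · intro h
    have := h0 ![1, 1, 1, h]
    simpa [PeriodDatum.fOmegaSbar, PeriodDatum.theta, PeriodDatum.thetaBase] using this

/-- «No isotropic subspace carries both theta summands» is implied by the input (no `PencilShadow` needed): a
non-zero wedge `(g 0 • θ_0) ∧ (g 1 • θ_1)` is a product of two elements of such a subspace. -/
theorem not_isotropic_of_wedgeNonzero (h : WedgeNonzero D) (P : Submodule ℂ HX) (hiso : WedgeIsotropic P) :
    ¬ (D.omega 0 ≤ P ∧ D.omega 1 ≤ P) := by
  rintro ⟨h0, h1⟩
  obtain ⟨g, hg⟩ := h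
  exact hg (hiso _ (h0 (D.theta_mem_omega g 0)) _ (h1 (D.theta_mem_omega g 1)))

/-- the same for the corners `2, 3` -/
theorem not_isotropic_of_wedgeNonzeroBar (h : WedgeNonzeroBar D) (P : Submodule ℂ HX)
    (hiso : WedgeIsotropic P) : ¬ (D.omega 2 ≤ P ∧ D.omega 3 ≤ P) := by
  rintro ⟨h2, h3⟩
  obtain ⟨g, hg⟩ := h
  exact hg (hiso _ (h2 (D.theta_mem_omega g 2)) _ (h3 (D.theta_mem_omega g 3)))

/-- Under the Castelnuovo–de Franchis shadow, the input L1.1 is EXACTLY «no Hecke-stable isotropic subspace of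
`H^{1,0}` contains both `omega 0` and `omega 1`» — the geometric name of the non-vanishing, equivalent to it, not
a printed input (module docstring §2). -/
theorem wedgeNonzero_iff_no_stable_isotropic (hP : PencilShadow D.S) :
    WedgeNonzero D ↔ ∀ P : Submodule ℂ HX, P ≤ D.S.H10 → HeckeStable G P → WedgeIsotropic P →
      ¬ (D.omega 0 ≤ P ∧ D.omega 1 ≤ P) := by
  constructor
  · intro h P _ _ hiso
    exact not_isotropic_of_wedgeNonzero D h P hiso
  · intro hno
    by_contra hcon
    have h0 : ∀ g : Fin 4 → G, D.fOmegaS g = 0 := fun g => by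
      by_contra hne
      exact hcon ⟨g, hne⟩
    obtain ⟨P, hle, hst, hiso, h0le, h1le⟩ := exists_stable_isotropic_of_forall_wedge_eq_zero D hP h0
    exact hno P hle hst hiso ⟨h0le, h1le⟩

/-- the same for L1.1′ and the corners `2, 3` -/
theorem wedgeNonzeroBar_iff_no_stable_isotropic (hP : PencilShadow D.S) :
    WedgeNonzeroBar D ↔ ∀ P : Submodule ℂ HX, P ≤ D.S.H10 → HeckeStable G P → WedgeIsotropic P →
      ¬ (D.omega 2 ≤ P ∧ D.omega 3 ≤ P) := by
  constructor
  · intro h P _ _ hiso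
    exact not_isotropic_of_wedgeNonzeroBar D h P hiso
  · intro hno
    by_contra hcon
    have h0 : ∀ g : Fin 4 → G, D.fOmegaSbar g = 0 := fun g => by
      by_contra hne
      exact hcon ⟨g, hne⟩
    obtain ⟨P, hle, hst, hiso, h2le, h3le⟩ := exists_stable_isotropic_of_forall_wedgeBar_eq_zero D hP h0
    exact hno P hle hst hiso ⟨h2le, h3le⟩

end Pencil

end

end Summit.Ventures.HodgeRepro2.Tier7.Line1
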